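import Mathlib
import Summits.CriticalPhenomena.SAWScalingLimit.Theorems.SAWDefectDecoherenceBoundaryClosureRGateTraceGreen
import Literature.Analysis.Complex.WeylLemmaDbar
import HarnessLib

/-!
# Real-line rigidity, step 1: the boundary measure of a reflected function is its trace
# (crux `BoundaryClosureR`, stmt-CriticalPhenomena-14004, line `polygon-parity-squeeze`,
# sub-goal (A2-main) `realLine_rigidity`, registered helper `realLine_localDensity`)

Let `G` be holomorphic on a disc `B = B(y, r)` centred on the real axis and suppose that, as a
distribution on `B`, `∂̄ (G 1_{B⁺})` is a one-phase measure carried by the diameter: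
`∫_{B⁺} G ∂̄φ dA = e ∫ φ(x) dν(x)` for all test functions `φ ∈ C_c^∞(B)`, with `ν ≥ 0` finite on
the diameter and `e ≠ 0`.  Green's formula for `G` (smooth up to the diameter) gives
`∫_{B⁺} G ∂̄φ = -(i/2) ∫ φ(x) G(x) dx`, so `e ν` and `-(i/2) G(x) dx` agree on the planar lifts
`φ(x + iy) = ψ(x) χ(y)` of line test functions `ψ`; hence (`realLine_localDensity`) the density
`g = -(i/2) e⁻¹ G` is a non-negative real on the diameter (bumps and continuity), and
`ν = g dx` on the middle half of the diameter (dominated convergence for bumps increasing to the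
indicator of an interval, then uniqueness of measures on `ℝ` from open intervals).  Only Mathlib,
the tree's `dbarAlong` API and the landed Green formula `GateTrace.gateTrace_green_halfPlane` are
used.
-/

noncomputable section

open scoped Topology ContDiff ENNReal
open Filter Set MeasureTheory Metric Complex
open Literature.Analysis.Complex (dbarAlong dbarAlong_eq_zero_of_notMem_tsupport)

namespace Summit.CriticalPhenomena.SAWScalingLimit.Theorems.PolygonParitySqueeze

namespace RealLine

/-- A continuous function supported inside an open set `V`, times a function continuous on `V`,
is continuous (off `V` the product vanishes near every point). [folklore] -/
theorem continuous_mul_of_tsupport_subset {α M : Type*} [TopologicalSpace α] [TopologicalSpace M]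
    [MulZeroClass M] [ContinuousMul M] {ψ g : α → M} {V : Set α} (hV : IsOpen V)
    (hψ : Continuous ψ) (hψV : tsupport ψ ⊆ V) (hg : ContinuousOn g V) :
    Continuous fun s => ψ s * g s := by
  refine continuous_iff_continuousAt.2 fun s => ?_
  by_cases hs : s ∈ V
  · exact hψ.continuousAt.mul (hg.continuousAt (hV.mem_nhds hs))
  · have hs' : s ∉ tsupport ψ := fun h => hs (hψV h)
    have hev : (fun _ => (0 : M)) =ᶠ[𝓝 s] fun w => ψ w * g w := by
      filter_upwards [notMem_tsupport_iff_eventuallyEq.1 hs'] with w hw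
      rw [hw, Pi.zero_apply, zero_mul]
    exact continuousAt_const.congr hev

/-- **Lifting a test function from the line to the plane.**  A smooth `ψ : ℝ → ℂ` compactly
supported in the open interval `(y - r, y + r)` is the restriction to the real axis of a smooth
test function `φ(x + iy) = ψ(x) χ(y)` on `ℂ` supported in the disc `B(y, r)` (`χ` a bump with
`χ(0) = 1` and small support). [folklore] -/
theorem exists_planar_test {ψ : ℝ → ℂ} (hψ : ContDiff ℝ ∞ ψ) (hψc : HasCompactSupport ψ)
    {y r : ℝ} (hr : 0 < r) (hsub : tsupport ψ ⊆ Ioo (y - r) (y + r)) :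
    ∃ φ : ℂ → ℂ, ContDiff ℝ ∞ φ ∧ HasCompactSupport φ ∧ tsupport φ ⊆ ball (y : ℂ) r ∧
      ∀ x : ℝ, φ x = ψ x := by
  -- a radius `ρ < r` with `tsupport ψ ⊆ [y - ρ, y + ρ]`
  obtain ⟨ρ, hρ0, hρr, hρ⟩ : ∃ ρ : ℝ, 0 ≤ ρ ∧ ρ < r ∧ ∀ s ∈ tsupport ψ, |s - y| ≤ ρ := by
    have hK : IsCompact (insert y (tsupport ψ)) := hψc.insert y
    obtain ⟨s₀, hs₀, hmax⟩ := hK.exists_isMaxOn ⟨y, mem_insert _ _⟩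
      ((continuous_id.sub continuous_const).abs.continuousOn : ContinuousOn (fun s : ℝ => |s - y|) _)
    refine ⟨|s₀ - y|, abs_nonneg _, ?_, fun s hs => hmax (mem_insert_of_mem _ hs)⟩
    rcases mem_insert_iff.1 hs₀ with h | h
    · rw [h, sub_self, abs_zero]; exact hr
    · have h' := mem_Ioo.1 (hsub h)
      rw [abs_lt]; constructor <;> linarith
  set η : ℝ := (r - ρ) / 2 with hη
  have hη0 : 0 < η := by rw [hη]; linarith
  let χ : ContDiffBump (0 : ℝ) := ⟨η / 2, η, by positivity, by linarith⟩
  set φ : ℂ → ℂ := fun w => ψ w.re * ((χ : ℝ → ℝ) w.im : ℂ) with hφdef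
  -- support of the lift
  have hsupp : Function.support φ ⊆ (re ⁻¹' tsupport ψ) ∩ (im ⁻¹' closedBall (0 : ℝ) η) := by
    intro w hw
    rw [Function.mem_support, hφdef] at hw
    refine ⟨subset_tsupport _ (left_ne_zero_of_mul hw), ?_⟩
    have h2 : ((χ : ℝ → ℝ) w.im : ℂ) ≠ 0 := right_ne_zero_of_mul hw
    have h3 : w.im ∈ Function.support (χ : ℝ → ℝ) := by
      rw [Function.mem_support]; exact_mod_cast h2
    rw [χ.support_eq] at h3
    exact ball_subset_closedBall h3
  have hclosed : IsClosed ((re ⁻¹' tsupport ψ) ∩ (im ⁻¹' closedBall (0 : ℝ) η)) :=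
    ((isClosed_tsupport ψ).preimage continuous_re).inter (isClosed_closedBall.preimage continuous_im)
  have hball : (re ⁻¹' tsupport ψ) ∩ (im ⁻¹' closedBall (0 : ℝ) η) ⊆ ball (y : ℂ) r := by
    rintro w ⟨hw1, hw2⟩
    rw [mem_preimage] at hw1 hw2
    rw [mem_closedBall, dist_zero_right, Real.norm_eq_abs] at hw2
    have h1 : |w.re - y| ≤ ρ := hρ _ hw1
    rw [mem_ball, dist_eq_norm]
    have hsq : ‖w - (y : ℂ)‖ ^ 2 = (w.re - y) ^ 2 + w.im ^ 2 := by
      rw [Complex.sq_norm, Complex.normSq_apply]; simp; ring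
    have h1' : (w.re - y) ^ 2 ≤ ρ ^ 2 := by
      rw [← sq_abs]; exact pow_le_pow_left₀ (abs_nonneg _) h1 2
    have h2' : w.im ^ 2 ≤ η ^ 2 := by
      rw [← sq_abs]; exact pow_le_pow_left₀ (abs_nonneg _) hw2 2
    have h3 : ρ ^ 2 + η ^ 2 < r ^ 2 := by rw [hη]; nlinarith
    exact lt_of_pow_lt_pow_left₀ 2 hr.le (by rw [hsq]; linarith)
  refine ⟨φ, ?_, ?_, (closure_minimal hsupp hclosed).trans hball, fun x => ?_⟩
  · exact (hψ.comp reCLM.contDiff).mul (ofRealCLM.contDiff.comp (χ.contDiff.comp imCLM.contDiff))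
  · exact HasCompactSupport.of_support_subset_isCompact (isCompact_closedBall (y : ℂ) r)
      ((hsupp.trans hball).trans ball_subset_closedBall)
  · have h0 : (χ : ℝ → ℝ) 0 = 1 := χ.one_of_mem_closedBall (mem_closedBall_self χ.rIn_pos.le)
    simp only [hφdef, ofReal_re, ofReal_im, h0, ofReal_one, mul_one]

variable {G : ℂ → ℂ} {y r : ℝ} {e : ℂ} {ν : Measure ℝ}

/-- **The boundary measure paired with a line test function.**  If `G` is holomorphic on
`B(y, r)` and `∫_{B⁺} G ∂̄φ = e ∫_{(y-r,y+r)} φ dν` for all test functions `φ` on `B(y, r)`, then for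
every smooth `ψ` compactly supported in `(y - r, y + r)`,
`∫_{(y-r,y+r)} ψ dν = ∫ ψ(x) · (-(i/2) e⁻¹ G(x)) dx` (Green's formula on the half-disc applied to the
planar lift of `ψ`). [folklore] -/
theorem line_pairing (hr : 0 < r) (he : e ≠ 0) (hG : DifferentiableOn ℂ G (ball (y : ℂ) r))
    (hpair : ∀ φ : ℂ → ℂ, ContDiff ℝ ∞ φ → HasCompactSupport φ → tsupport φ ⊆ ball (y : ℂ) r →
      ∫ w in ball (y : ℂ) r ∩ {w : ℂ | 0 < w.im}, G w * dbarAlong 1 φ w =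
        e * ∫ x in Ioo (y - r) (y + r), φ x ∂ν)
    {ψ : ℝ → ℂ} (hψ : ContDiff ℝ ∞ ψ) (hψc : HasCompactSupport ψ)
    (hsub : tsupport ψ ⊆ Ioo (y - r) (y + r)) :
    ∫ x in Ioo (y - r) (y + r), ψ x ∂ν = ∫ x : ℝ, ψ x * (-(I / 2) * e⁻¹ * G x) := by
  obtain ⟨φ, hφ, hφc, hφs, hφψ⟩ := exists_planar_test hψ hψc hr hsub
  have h1 := hpair φ hφ hφc hφs
  have hGd : DifferentiableOn ℂ G ({z : ℂ | (0 : ℝ) < z.im} ∩ ball (y : ℂ) r) :=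
    hG.mono inter_subset_right
  have hGc : ContinuousOn G ({z : ℂ | (0 : ℝ) ≤ z.im} ∩ ball (y : ℂ) r) :=
    hG.continuousOn.mono inter_subset_right
  have h2 := GateTrace.gateTrace_green_halfPlane G φ 0 (ball (y : ℂ) r) isOpen_ball hGd hGc
    (hφ.of_le (by exact_mod_cast le_top)) hφc hφs
  simp only [ofReal_zero, zero_mul, add_zero, hφψ] at h2
  have h3 : ∫ w in ball (y : ℂ) r ∩ {w : ℂ | 0 < w.im}, G w * dbarAlong 1 φ w =
      ∫ z in {z : ℂ | (0 : ℝ) < z.im}, dbarAlong 1 φ z * G z := by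
    rw [inter_comm]
    simp_rw [mul_comm (G _)]
    refine (setIntegral_eq_of_subset_of_forall_sdiff_eq_zero
      (isOpen_lt continuous_const continuous_im).measurableSet inter_subset_left ?_).symm
    rintro z ⟨hz, hz'⟩
    have hzb : z ∉ ball (y : ℂ) r := fun h => hz' ⟨hz, h⟩
    rw [dbarAlong_eq_zero_of_notMem_tsupport fun h => hzb (hφs h), zero_mul]
  calc ∫ x in Ioo (y - r) (y + r), ψ x ∂ν
      = e⁻¹ * (e * ∫ x in Ioo (y - r) (y + r), ψ x ∂ν) := by
        rw [← mul_assoc, inv_mul_cancel₀ he, one_mul]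
    _ = e⁻¹ * (e * ∫ x in Ioo (y - r) (y + r), φ x ∂ν) := by simp_rw [hφψ]
    _ = e⁻¹ * (-(I / 2) * ∫ x : ℝ, ψ x * G x) := by rw [← h1, h3, h2]
    _ = ∫ x : ℝ, ψ x * (-(I / 2) * e⁻¹ * G x) := by
        rw [← mul_assoc, ← integral_const_mul]
        congr 1
        ext x
        ring


/-- **Bump pairing, real form.**  Under the hypotheses of `line_pairing`, for a real bump `ψ₀`
supported in `(y - r, y + r)` the number `∫ ψ₀ dν` equals `∫ ψ₀ · re g` and `∫ ψ₀ · im g = 0`,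
where `g = -(i/2) e⁻¹ G` on the axis. [folklore] -/
theorem bump_pairing (hr : 0 < r) (he : e ≠ 0) (hG : DifferentiableOn ℂ G (ball (y : ℂ) r))
    (hpair : ∀ φ : ℂ → ℂ, ContDiff ℝ ∞ φ → HasCompactSupport φ → tsupport φ ⊆ ball (y : ℂ) r →
      ∫ w in ball (y : ℂ) r ∩ {w : ℂ | 0 < w.im}, G w * dbarAlong 1 φ w =
        e * ∫ x in Ioo (y - r) (y + r), φ x ∂ν)
    {c : ℝ} (ψ₀ : ContDiffBump c) (hψ₀ : closedBall c ψ₀.rOut ⊆ Ioo (y - r) (y + r)) :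
    (∫ x in Ioo (y - r) (y + r), ψ₀ x ∂ν) = ∫ x : ℝ, ψ₀ x * (-(I / 2) * e⁻¹ * G x).re ∧
      ∫ x : ℝ, ψ₀ x * (-(I / 2) * e⁻¹ * G x).im = 0 := by
  set g : ℝ → ℂ := fun x => -(I / 2) * e⁻¹ * G x with hg
  have hψ : ContDiff ℝ ∞ (fun s => ((ψ₀ s : ℝ) : ℂ)) := ofRealCLM.contDiff.comp ψ₀.contDiff
  have hψc : HasCompactSupport (fun s => ((ψ₀ s : ℝ) : ℂ)) :=
    ψ₀.hasCompactSupport.comp_left (g := ofReal) ofReal_zero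
  have hsub : tsupport (fun s => ((ψ₀ s : ℝ) : ℂ)) ⊆ Ioo (y - r) (y + r) :=
    ((tsupport_comp_subset (g := ofReal) ofReal_zero _).trans (ψ₀.tsupport_eq.le)).trans hψ₀
  have h := line_pairing hr he hG hpair hψ hψc hsub
  -- continuity of `g` on the interval and integrability of `ψ₀ g`
  have hgc : ContinuousOn g (Ioo (y - r) (y + r)) := by
    refine ((continuousOn_const.mul (hG.continuousOn.comp continuous_ofReal.continuousOn ?_)))
    intro s hs
    rw [mem_ball, dist_eq_norm, ← ofReal_sub, norm_real, Real.norm_eq_abs, abs_lt]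
    constructor <;> linarith [hs.1, hs.2]
  have hcont : Continuous fun s => ((ψ₀ s : ℝ) : ℂ) * g s :=
    continuous_mul_of_tsupport_subset isOpen_Ioo (continuous_ofReal.comp ψ₀.continuous) hsub hgc
  have hint : Integrable fun s => ((ψ₀ s : ℝ) : ℂ) * g s :=
    hcont.integrable_of_hasCompactSupport hψc.mul_right
  have hre := integral_re hint
  have him := integral_im hint
  simp only [RCLike.re_to_complex, RCLike.im_to_complex, re_ofReal_mul, im_ofReal_mul] at hre him
  rw [integral_complex_ofReal] at h
  refine ⟨?_, ?_⟩
  · rw [hre, ← h, ofReal_re]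
  · rw [him, ← h, ofReal_im]

/-- A continuous function whose integrals against all small bumps at `t` are non-negative is
non-negative at `t`. [folklore] -/
theorem nonneg_of_bump_integrals {q : ℝ → ℝ} {V : Set ℝ} (hV : IsOpen V) (hq : ContinuousOn q V)
    {t : ℝ} (ht : t ∈ V)
    (h : ∀ ψ₀ : ContDiffBump t, closedBall t ψ₀.rOut ⊆ V → 0 ≤ ∫ s, ψ₀ s * q s) : 0 ≤ q t := by
  by_contra hlt
  rw [not_le] at hlt
  -- near `t`, `q < q t / 2 < 0`
  have hev : ∀ᶠ s in 𝓝 t, q s < q t / 2 ∧ s ∈ V :=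
    ((hq.continuousAt (hV.mem_nhds ht)).eventually_lt continuousAt_const (by linarith)).and
      (hV.mem_nhds ht)
  obtain ⟨δ, hδ, hδ'⟩ := Metric.eventually_nhds_iff.1 hev
  let ψ₀ : ContDiffBump t := ⟨δ / 4, δ / 2, by positivity, by linarith⟩
  have hsub : closedBall t ψ₀.rOut ⊆ V := fun s hs =>
    (hδ' (lt_of_le_of_lt (mem_closedBall.1 hs) (by show δ / 2 < δ; linarith))).2
  have hψV : tsupport (ψ₀ : ℝ → ℝ) ⊆ V := ψ₀.tsupport_eq ▸ hsub
  set F : ℝ → ℝ := fun s => ψ₀ s * (-q s) with hF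
  have hFc : Continuous F :=
    continuous_mul_of_tsupport_subset hV ψ₀.continuous hψV (hq.neg)
  have hFs : HasCompactSupport F := ψ₀.hasCompactSupport.mul_right
  have hF0 : 0 ≤ F := by
    intro s
    show 0 ≤ ψ₀ s * (-q s)
    by_cases hs : dist s t < δ
    · have := (hδ' hs).1
      exact mul_nonneg (ψ₀.nonneg) (by linarith)
    · rw [ψ₀.zero_of_le_dist (le_trans (by show δ / 2 ≤ δ; linarith) (not_lt.1 hs)), zero_mul]
  have hFt : F t ≠ 0 := by
    simp only [hF]
    rw [ψ₀.one_of_mem_closedBall (mem_closedBall_self ψ₀.rIn_pos.le), one_mul]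
    linarith
  have hpos := hFc.integral_pos_of_hasCompactSupport_nonneg_nonzero (μ := volume) hFs hF0 hFt
  have hneg : ∫ s, F s = -∫ s, ψ₀ s * q s := by
    rw [← integral_neg]
    congr 1
    ext s
    simp only [hF]
    ring
  linarith [h ψ₀ hsub]

/-- **The density is a non-negative real.**  Under the hypotheses of `line_pairing`,
`g(t) = -(i/2) e⁻¹ G(t)` has `im g(t) = 0` and `re g(t) ≥ 0` for `t ∈ (y - r, y + r)`: its bump
integrals are the non-negative reals `∫ ψ₀ dν`. [folklore] -/
theorem density_nonneg (hr : 0 < r) (he : e ≠ 0) (hG : DifferentiableOn ℂ G (ball (y : ℂ) r))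
    (hpair : ∀ φ : ℂ → ℂ, ContDiff ℝ ∞ φ → HasCompactSupport φ → tsupport φ ⊆ ball (y : ℂ) r →
      ∫ w in ball (y : ℂ) r ∩ {w : ℂ | 0 < w.im}, G w * dbarAlong 1 φ w =
        e * ∫ x in Ioo (y - r) (y + r), φ x ∂ν)
    {t : ℝ} (ht : t ∈ Ioo (y - r) (y + r)) :
    (-(I / 2) * e⁻¹ * G t).im = 0 ∧ 0 ≤ (-(I / 2) * e⁻¹ * G t).re := by
  set g : ℝ → ℂ := fun x => -(I / 2) * e⁻¹ * G x with hg
  have hgc : ContinuousOn g (Ioo (y - r) (y + r)) := by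
    refine ((continuousOn_const.mul (hG.continuousOn.comp continuous_ofReal.continuousOn ?_)))
    intro s hs
    rw [mem_ball, dist_eq_norm, ← ofReal_sub, norm_real, Real.norm_eq_abs, abs_lt]
    constructor <;> linarith [hs.1, hs.2]
  have hrec : ContinuousOn (fun s => (g s).re) (Ioo (y - r) (y + r)) :=
    continuous_re.comp_continuousOn hgc
  have himc : ContinuousOn (fun s => (g s).im) (Ioo (y - r) (y + r)) :=
    continuous_im.comp_continuousOn hgc
  have him0 : 0 ≤ (g t).im :=
    nonneg_of_bump_integrals isOpen_Ioo himc ht fun ψ₀ hψ₀ =>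
      (bump_pairing hr he hG hpair ψ₀ hψ₀).2.symm.le
  have him1 : 0 ≤ -(g t).im := by
    refine nonneg_of_bump_integrals isOpen_Ioo himc.neg ht fun ψ₀ hψ₀ => ?_
    have h2 := (bump_pairing hr he hG hpair ψ₀ hψ₀).2
    have h3 : ∫ s, ψ₀ s * -(-(I / 2) * e⁻¹ * G s).im = -∫ s, ψ₀ s * (-(I / 2) * e⁻¹ * G s).im := by
      rw [← integral_neg]; congr 1; ext s; ring
    show 0 ≤ ∫ s, ψ₀ s * -(-(I / 2) * e⁻¹ * G s).im
    rw [h3, h2, neg_zero]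
  have hre0 : 0 ≤ (g t).re := by
    refine nonneg_of_bump_integrals isOpen_Ioo hrec ht fun ψ₀ hψ₀ => ?_
    rw [← (bump_pairing hr he hG hpair ψ₀ hψ₀).1]
    exact setIntegral_nonneg measurableSet_Ioo fun s _ => ψ₀.nonneg
  exact ⟨le_antisymm (by linarith) him0, hre0⟩


/-- **Masses of intervals.**  Under the hypotheses of `line_pairing` and with
`ν (y - r, y + r) < ∞`: for `y - r < a < b < y + r`, `ν (a, b) = ∫_{(a,b)} re g` with
`g = -(i/2) e⁻¹ G` (bumps `ψₙ ↑ 1_{(a,b)}` and dominated convergence on both sides of the bump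
pairing). [folklore] -/
theorem measure_Ioo_eq (hr : 0 < r) (he : e ≠ 0) (hG : DifferentiableOn ℂ G (ball (y : ℂ) r))
    (hν : ν (Ioo (y - r) (y + r)) < ⊤)
    (hpair : ∀ φ : ℂ → ℂ, ContDiff ℝ ∞ φ → HasCompactSupport φ → tsupport φ ⊆ ball (y : ℂ) r →
      ∫ w in ball (y : ℂ) r ∩ {w : ℂ | 0 < w.im}, G w * dbarAlong 1 φ w =
        e * ∫ x in Ioo (y - r) (y + r), φ x ∂ν)
    {a b : ℝ} (ha : y - r < a) (hab : a < b) (hb : b < y + r) :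
    ν (Ioo a b) = ∫⁻ s in Ioo a b, ENNReal.ofReal (-(I / 2) * e⁻¹ * G s).re := by
  set g : ℝ → ℂ := fun x => -(I / 2) * e⁻¹ * G x with hg
  set c : ℝ := (a + b) / 2 with hc
  set ℓ : ℝ := (b - a) / 2 with hℓ
  have hℓ0 : 0 < ℓ := by rw [hℓ]; linarith
  have hIoo : Ioo a b ⊆ Ioo (y - r) (y + r) := Ioo_subset_Ioo ha.le hb.le
  have hIcc : Icc a b ⊆ Ioo (y - r) (y + r) := fun s hs => ⟨by linarith [hs.1], by linarith [hs.2]⟩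
  have hball : ball c ℓ = Ioo a b := by
    rw [Real.ball_eq_Ioo]; congr 1 <;> (rw [hc, hℓ]; ring)
  have hcball : closedBall c ℓ = Icc a b := by
    rw [Real.closedBall_eq_Icc]; congr 1 <;> (rw [hc, hℓ]; ring)
  -- the bumps `ψ n`: equal to `1` on `closedBall c (ℓ (n+1)/(n+2))`, supported in `ball c ℓ`
  have hrad : ∀ n : ℕ, 0 < ℓ * ((n + 1) / (n + 2)) ∧
      ℓ * ((n + 1) / (n + 2)) < ℓ * ((2 * n + 3) / (2 * n + 4)) ∧
      ℓ * ((2 * n + 3) / (2 * n + 4)) < ℓ := by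
    intro n
    have hn : (0 : ℝ) ≤ n := n.cast_nonneg
    refine ⟨by positivity, ?_, ?_⟩
    · refine mul_lt_mul_of_pos_left ?_ hℓ0
      rw [div_lt_div_iff₀ (by positivity) (by positivity)]; nlinarith
    · calc ℓ * ((2 * n + 3) / (2 * n + 4)) < ℓ * 1 := by
            refine mul_lt_mul_of_pos_left ?_ hℓ0
            rw [div_lt_one (by positivity)]; linarith
        _ = ℓ := mul_one ℓ
  let ψ : ℕ → ContDiffBump c := fun n =>
    ⟨ℓ * ((n + 1) / (n + 2)), ℓ * ((2 * n + 3) / (2 * n + 4)), (hrad n).1, (hrad n).2.1⟩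
  have hψsub : ∀ n, closedBall c (ψ n).rOut ⊆ Ioo (y - r) (y + r) := fun n =>
    ((closedBall_subset_closedBall (hrad n).2.2.le).trans hcball.le).trans hIcc
  have hψzero : ∀ n s, s ∉ Ioo a b → ψ n s = 0 := by
    intro n s hs
    apply (ψ n).zero_of_le_dist
    have h1 : ℓ ≤ dist s c := by
      by_contra h
      exact hs (hball ▸ (mem_ball.2 (not_le.1 h)))
    exact (hrad n).2.2.le.trans h1
  have hψone : ∀ s ∈ Ioo a b, ∃ N : ℕ, ∀ n ≥ N, ψ n s = 1 := by
    intro s hs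
    have hsd : dist s c < ℓ := by rw [← mem_ball, hball]; exact hs
    have hd : 0 < ℓ - dist s c := by linarith
    obtain ⟨N, hN⟩ := exists_nat_gt (ℓ / (ℓ - dist s c))
    refine ⟨N, fun n hn => (ψ n).one_of_mem_closedBall ?_⟩
    rw [mem_closedBall]
    show dist s c ≤ ℓ * ((n + 1) / (n + 2))
    have hn' : ℓ / (ℓ - dist s c) < n + 2 := by
      have : (N : ℝ) ≤ n := by exact_mod_cast hn
      linarith
    rw [div_lt_iff₀ hd] at hn'
    rw [mul_div_assoc', le_div_iff₀ (by positivity)]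
    nlinarith [hn', dist_nonneg (x := s) (y := c)]
  -- the bump pairings, rewritten on `(a, b)`
  have hI : ∀ n, (∫ s in Ioo a b, ψ n s ∂ν) = ∫ s in Ioo a b, ψ n s * (g s).re := by
    intro n
    have h1 := (bump_pairing hr he hG hpair (ψ n) (hψsub n)).1
    rw [setIntegral_eq_of_subset_of_forall_sdiff_eq_zero measurableSet_Ioo hIoo
      (fun s hs => hψzero n s hs.2)] at h1
    rw [h1]
    exact (setIntegral_eq_integral_of_forall_compl_eq_zero fun s hs => by
      rw [hψzero n s hs, zero_mul]).symm
  -- the `ν` side tends to `ν (a, b)`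
  have hfin : ν (Ioo a b) < ⊤ := (measure_mono hIoo).trans_lt hν
  haveI : IsFiniteMeasure (ν.restrict (Ioo a b)) := isFiniteMeasure_restrict.2 hfin.ne
  have hL1 : Tendsto (fun n => ∫ s in Ioo a b, (ψ n s : ℝ) ∂ν) atTop
      (𝓝 (∫ _ in Ioo a b, (1 : ℝ) ∂ν)) := by
    refine tendsto_integral_of_dominated_convergence (fun _ => (1 : ℝ))
      (fun n => (ψ n).continuous.aestronglyMeasurable) (integrable_const _)
      (fun n => Eventually.of_forall fun s => ?_) ?_
    · rw [Real.norm_eq_abs, abs_of_nonneg (ψ n).nonneg]; exact (ψ n).le_one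
    · refine (ae_restrict_iff' measurableSet_Ioo).2 (Eventually.of_forall fun s hs => ?_)
      obtain ⟨N, hN⟩ := hψone s hs
      exact tendsto_atTop_of_eventually_const hN
  have hL1' : ∫ _ in Ioo a b, (1 : ℝ) ∂ν = (ν (Ioo a b)).toReal := by
    rw [setIntegral_const, smul_eq_mul, mul_one, measureReal_def]
  -- the density side tends to `∫_{(a,b)} re g`
  have hgc : ContinuousOn g (Ioo (y - r) (y + r)) := by
    refine ((continuousOn_const.mul (hG.continuousOn.comp continuous_ofReal.continuousOn ?_)))
    intro s hs
    rw [mem_ball, dist_eq_norm, ← ofReal_sub, norm_real, Real.norm_eq_abs, abs_lt]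
    constructor <;> linarith [hs.1, hs.2]
  have hrec : ContinuousOn (fun s => (g s).re) (Icc a b) :=
    (continuous_re.comp_continuousOn hgc).mono hIcc
  have hgi : IntegrableOn (fun s => (g s).re) (Ioo a b) :=
    hrec.integrableOn_Icc.mono_set Ioo_subset_Icc_self
  have hL2 : Tendsto (fun n => ∫ s in Ioo a b, ψ n s * (g s).re) atTop
      (𝓝 (∫ s in Ioo a b, (g s).re)) := by
    refine tendsto_integral_of_dominated_convergence (fun s => ‖(g s).re‖) (fun n => ?_) hgi.norm
      (fun n => Eventually.of_forall fun s => ?_) ?_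
    · exact ((ψ n).continuous.continuousOn.mul (hrec.mono Ioo_subset_Icc_self)).aestronglyMeasurable
        measurableSet_Ioo
    · rw [norm_mul, Real.norm_eq_abs, abs_of_nonneg (ψ n).nonneg]
      exact mul_le_of_le_one_left (norm_nonneg _) (ψ n).le_one
    · refine (ae_restrict_iff' measurableSet_Ioo).2 (Eventually.of_forall fun s hs => ?_)
      obtain ⟨N, hN⟩ := hψone s hs
      exact tendsto_atTop_of_eventually_const (i₀ := N) fun n hn => by rw [hN n hn, one_mul]
  -- conclusion
  have heq : (ν (Ioo a b)).toReal = ∫ s in Ioo a b, (g s).re := by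
    rw [← hL1']
    exact tendsto_nhds_unique (hL1.congr fun n => hI n) hL2
  have hnn : 0 ≤ᵐ[volume.restrict (Ioo a b)] fun s => (g s).re :=
    (ae_restrict_iff' measurableSet_Ioo).2 (Eventually.of_forall fun s hs =>
      (density_nonneg hr he hG hpair (hIoo hs)).2)
  rw [← ENNReal.ofReal_toReal hfin.ne, heq, ofReal_integral_eq_lintegral_ofReal hgi hnn]

/-- **Registered helper `realLine_localDensity`** (step (1) of `realLine_rigidity`, line
`polygon-parity-squeeze`).  Let `G` be holomorphic on `B(y, r)` and let `ν ≥ 0` be finite on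
`(y - r, y + r)` with `∫_{B⁺} G ∂̄φ = e ∫_{(y-r,y+r)} φ dν` for all test functions `φ` supported
in `B(y, r)` (`e ≠ 0`).  Then the density `g = -(i/2) e⁻¹ G` is a non-negative real on the
diameter, and `ν = (re g) dx` on its middle half `(y - r/2, y + r/2)` (interval masses from
`measure_Ioo_eq`, uniqueness of locally finite measures on `ℝ` from rational open intervals).
[folklore] -/
theorem realLine_localDensity : ∀ (G : ℂ → ℂ) (y r : ℝ) (e : ℂ) (ν : MeasureTheory.Measure ℝ), 0 < r → e ≠ 0 → DifferentiableOn ℂ G (Metric.ball (y : ℂ) r) → ν (Set.Ioo (y - r) (y + r)) < ⊤ → (∀ φ : ℂ → ℂ, ContDiff ℝ ∞ φ → HasCompactSupport φ → tsupport φ ⊆ Metric.ball (y : ℂ) r → ∫ w in Metric.ball (y : ℂ) r ∩ {w : ℂ | 0 < w.im}, G w * Literature.Analysis.Complex.dbarAlong 1 φ w = e * ∫ x in Set.Ioo (y - r) (y + r), φ (x : ℂ) ∂ν) → (∀ t ∈ Set.Ioo (y - r) (y + r), (-(Complex.I / 2) * e⁻¹ * G t).im = 0 ∧ 0 ≤ (-(Complex.I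 / 2) * e⁻¹ * G t).re) ∧ ν.restrict (Set.Ioo (y - r / 2) (y + r / 2)) = (MeasureTheory.volume.withDensity fun t : ℝ => ENNReal.ofReal (-(Complex.I / 2) * e⁻¹ * G t).re).restrict (Set.Ioo (y - r / 2) (y + r / 2)) := by
  intro G y r e ν hr he hG hν hpair
  refine ⟨fun t ht => density_nonneg hr he hG hpair ht, ?_⟩
  have hI' : Ioo (y - r / 2) (y + r / 2) ⊆ Ioo (y - r) (y + r) :=
    Ioo_subset_Ioo (by linarith) (by linarith)
  haveI : IsFiniteMeasure (ν.restrict (Ioo (y - r / 2) (y + r / 2))) :=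
    isFiniteMeasure_restrict.2 ((measure_mono hI').trans_lt hν).ne
  refine Real.measure_ext_Ioo_rat fun p q => ?_
  rw [Measure.restrict_apply measurableSet_Ioo, Measure.restrict_apply measurableSet_Ioo,
    Ioo_inter_Ioo, withDensity_apply _ measurableSet_Ioo]
  rcases lt_or_ge (max (p : ℝ) (y - r / 2)) (min (q : ℝ) (y + r / 2)) with hlt | hle
  · refine measure_Ioo_eq hr he hG hν hpair ?_ hlt ?_
    · exact lt_of_lt_of_le (by linarith) (le_max_right _ _)
    · exact lt_of_le_of_lt (min_le_right _ _) (by linarith)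
  · rw [Ioo_eq_empty (not_lt.2 hle), measure_empty, Measure.restrict_empty, lintegral_zero_measure]

end RealLine

end Summit.CriticalPhenomena.SAWScalingLimit.Theorems.PolygonParitySqueeze

end
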